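/-
Copyright (c) 2026. All rights reserved.
Released under Apache 2.0 license as described in the file LICENSE.
Authors: HodgeCM publication cell (pub/hodgecm-mathlib), Track B, seat K2E3-p25 (g0).
-/
import Summits.HodgeConjecture.HodgeConjecture.Theorems.K2E3GL3BorelJacquetExponents    -- ★ E3δ
import HarnessLib

/-!
# K2_E3 road (h413), leaf (nsc-S-A′), brick H0-a — the exponents of `I(θ) = θ₀ × θ₁ × θ₂` in the `tch`-currency: `mult (I θ) η = #{w ∈ S₃ : η = tch(θ ∘ w⁻¹)}`
Cell `pub/hodgecm-mathlib` (D-0151), Track B, seat K2E3-p25 (g0).  `--supports stmt-HodgeConjecture-24833 --as helper`; THEOREMS ONLY; COUNT-NEUTRAL.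
For a triple `θ : Fin 3 → (Fˣ →* ℂˣ)` the H-layer's character of the diagonal torus is `tch θ = ∏_a (θ a) ∘ det ∘ ev_a` (CONVENTIONS 08:40Z).  Here: the exponent of the cell `w`
of ★ E3δ, `χ ∘ levi ∘ Ad(P_w) ∘ diag` for `χ = tch θ`, IS `tch (θ ∘ w⁻¹)` (`(P_w diag(d) P_w⁻¹)_{aa} = d_{w a}`), so ★ E3δ reads
**`mult (I θ) η = #{w ∈ S₃ : η = tch (θ ∘ w⁻¹)}`** for every `η : T → ℂ`. [cite: BernsteinZelevinsky1977, §2.12, Thm. 5.2] [cite: Casselman1995, Thm. 6.3.5]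
HONEST LABEL: HC_CM is proved only modulo the 7 printed citations (2 remaining named inputs: hLiu418 = stmt-HodgeConjecture-24832, h413 = stmt-HodgeConjecture-24833) until rung 0 closes.
-/

set_option autoImplicit false
set_option linter.dupNamespace false

noncomputable section

open Set Function Representation Module
open scoped MatrixGroups

namespace Summit.HodgeConjecture.HodgeConjecture.Cruxes.H413.K2E3GL3PrincipalSeriesExponents

open Literature.NumberTheory.Automorphic ValuativeRel
open Summit.HodgeConjecture.HodgeConjecture.Cruxes.H413.K2E3GL3BruhatCellSubgroups
open Summit.HodgeConjecture.HodgeConjecture.Cruxes.H413.K2E3BorelCellJacquetLine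
open Summit.HodgeConjecture.HodgeConjecture.Cruxes.H413.K2E3GL3BorelJacquetExponents

variable {F : Type} [Field F]

/-- The determinant of a `1 × 1` block of the Borel Levi is its entry. [folklore] -/
theorem det_fin_one_block (a : Fin 3) (g : GL {i : Fin 3 // (id : Fin 3 → Fin 3) i = a} F) :
    ((Matrix.GeneralLinearGroup.det g : Fˣ) : F) = ((g : GL {i : Fin 3 // (id : Fin 3 → Fin 3) i = a} F) : Matrix {i : Fin 3 // (id : Fin 3 → Fin 3) i = a} {i : Fin 3 // (id : Fin 3 → Fin 3) i = a} F) ⟨a, rfl⟩ ⟨a, rfl⟩ := by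
  haveI : Unique {i : Fin 3 // (id : Fin 3 → Fin 3) i = a} := ⟨⟨⟨a, rfl⟩⟩, fun x => Subtype.ext x.2⟩
  rw [Matrix.GeneralLinearGroup.val_det_apply, Matrix.det_unique]
  have h1 : (default : {i : Fin 3 // (id : Fin 3 → Fin 3) i = a}) = ⟨a, rfl⟩ := Subsingleton.elim _ _
  rw [h1]

/-- **The exponent of the cell `w` in the `tch`-currency**: for `χ = tch θ`, `χ(levi(P_w diag(m) P_w⁻¹)) = tch(θ ∘ w⁻¹)(m)`, because the `a`-th diagonal entry of
`P_w diag(m) P_w⁻¹` is the `(w a)`-th of `diag(m)`. [cite: BernsteinZelevinsky1977, Thm. 5.2] -/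
theorem tch_leviProjection_permGL_conj (θ : Fin 3 → (Fˣ →* ℂˣ)) (w : Equiv.Perm (Fin 3)) (m : (Π a : Fin 3, GL {i : Fin 3 // (id : Fin 3 → Fin 3) i = a} F)) :
    (∏ a : Fin 3, ((θ) a).comp ((Matrix.GeneralLinearGroup.det : GL {i : Fin 3 // (id : Fin 3 → Fin 3) i = a} F →* Fˣ).comp (Pi.evalMonoidHom (fun b : Fin 3 => GL {i : Fin 3 // (id : Fin 3 → Fin 3) i = b} F) a))) (leviProjection F (id : Fin 3 → Fin 3) ⟨(permGL (w) : GL (Fin 3) F) * blockDiagonalGL F (id : Fin 3 → Fin 3) m * (permGL (w) : GL (Fin 3) F)⁻¹, permGL_conj_blockDiagonalGL_mem_borel w m⟩) =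
      (∏ a : Fin 3, ((fun a => θ (w.symm a)) a).comp ((Matrix.GeneralLinearGroup.det : GL {i : Fin 3 // (id : Fin 3 → Fin 3) i = a} F →* Fˣ).comp (Pi.evalMonoidHom (fun b : Fin 3 => GL {i : Fin 3 // (id : Fin 3 → Fin 3) i = b} F) a))) m := by
  rw [MonoidHom.finsetProd_apply, MonoidHom.finsetProd_apply]
  -- the `a`-th factor on the left is the `(w a)`-th factor on the right
  have hdet : ∀ a : Fin 3, Matrix.GeneralLinearGroup.det (leviProjection F (id : Fin 3 → Fin 3)
      ⟨(permGL (w) : GL (Fin 3) F) * blockDiagonalGL F (id : Fin 3 → Fin 3) m * (permGL (w) : GL (Fin 3) F)⁻¹, permGL_conj_blockDiagonalGL_mem_borel w m⟩ a) = Matrix.GeneralLinearGroup.det (m (w a)) := by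
    intro a
    apply Units.ext
    rw [det_fin_one_block, det_fin_one_block, leviProjection_apply_coe]
    change ((((permGL (w) : GL (Fin 3) F) * blockDiagonalGL F (id : Fin 3 → Fin 3) m * (permGL (w) : GL (Fin 3) F)⁻¹ : GL (Fin 3) F)) : Matrix (Fin 3) (Fin 3) F) a a = _
    rw [permGL_conj_apply, blockDiagonalGL_apply_coe_dite, dif_pos rfl]
    rfl
  simp only [MonoidHom.coe_comp, Function.comp_apply, Pi.evalMonoidHom_apply, hdet]
  exact Fintype.prod_equiv w _ _ fun a => by simp

section LocalField

variable [ValuativeRel F] [TopologicalSpace F] [IsNonarchimedeanLocalField F]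

set_option maxHeartbeats 400000 in
open scoped Classical in
/-- **THE EXPONENTS OF `I(θ) = θ₀ × θ₁ × θ₂` (GL₃ principal series) WITH MULTIPLICITY, `tch`-currency.**  For `θ : Fin 3 → (F^× →* ℂ^×)` with `ker (tch θ)` open and
`I(θ) = parabolicIndGL F id (𝟙.twist (tch θ))` (unfolded): `r_B(I θ)` is finite-dimensional and, for every `η : T → ℂ`,
`dim (r_B I θ)_η = #{w ∈ S₃ : η = tch (θ ∘ w⁻¹)}` (★ E3δ + `tch_leviProjection_permGL_conj`). [cite: BernsteinZelevinsky1977, §2.12, Thm. 5.2] [cite: Casselman1995, §6.3, Thm. 6.3.5] -/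
theorem finrank_weightSpace_principalSeries_three_tch (θ : Fin 3 → (Fˣ →* ℂˣ))
    (hθ : IsOpen (((∏ a : Fin 3, ((θ) a).comp ((Matrix.GeneralLinearGroup.det : GL {i : Fin 3 // (id : Fin 3 → Fin 3) i = a} F →* Fˣ).comp (Pi.evalMonoidHom (fun b : Fin 3 => GL {i : Fin 3 // (id : Fin 3 → Fin 3) i = b} F) a)))).ker : Set (Π a : Fin 3, GL {i : Fin 3 // (id : Fin 3 → Fin 3) i = a} F))) (η : (Π a : Fin 3, GL {i : Fin 3 // (id : Fin 3 → Fin 3) i = a} F) → ℂ) :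
    FiniteDimensional ℂ (restrictUnipotentGL F (id : Fin 3 → Fin 3) (smoothIndRep (standardParabolicGL F (id : Fin 3 → Fin 3)) (Representation.twist (((Representation.trivial ℂ (Π a : Fin 3, GL {i : Fin 3 // (id : Fin 3 → Fin 3) i = a} F) ℂ).twist (∏ a : Fin 3, ((θ) a).comp ((Matrix.GeneralLinearGroup.det : GL {i : Fin 3 // (id : Fin 3 → Fin 3) i = a} F →* Fˣ).comp (Pi.evalMonoidHom (fun b : Fin 3 => GL {i : Fin 3 // (id : Fin 3 → Fin 3) i = b} F) a)))).comp (leviProjection F (id : Fin 3 → Fin 3))) (rootDeltaChar (standardParabolicGL F (id : Fin 3 → Fin 3)))))).Coinvariants ∧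
    finrank ℂ ↥(⨅ m, Module.End.maxGenEigenspace (Representation.normalizedJacquetGL F (id : Fin 3 → Fin 3) (smoothIndRep (standardParabolicGL F (id : Fin 3 → Fin 3)) (Representation.twist (((Representation.trivial ℂ (Π a : Fin 3, GL {i : Fin 3 // (id : Fin 3 → Fin 3) i = a} F) ℂ).twist (∏ a : Fin 3, ((θ) a).comp ((Matrix.GeneralLinearGroup.det : GL {i : Fin 3 // (id : Fin 3 → Fin 3) i = a} F →* Fˣ).comp (Pi.evalMonoidHom (fun b : Fin 3 => GL {i : Fin 3 // (id : Fin 3 → Fin 3) i = b} F) a)))).comp (leviProjection F (id : Fin 3 → Fin 3))) (rootDeltaChar (standardParabolicGL F (id : Fin 3 → Fin 3))))) m) (η m)) =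
      ((Finset.univ : Finset (Equiv.Perm (Fin 3))).filter fun w => η = fun m => (((∏ a : Fin 3, ((fun a => θ (w.symm a)) a).comp ((Matrix.GeneralLinearGroup.det : GL {i : Fin 3 // (id : Fin 3 → Fin 3) i = a} F →* Fˣ).comp (Pi.evalMonoidHom (fun b : Fin 3 => GL {i : Fin 3 // (id : Fin 3 → Fin 3) i = b} F) a))) m : ℂˣ) : ℂ)).card := by
  obtain ⟨hfd, h⟩ := finrank_weightSpace_normalizedJacquetGL_principalSeries_three ((∏ a : Fin 3, ((θ) a).comp ((Matrix.GeneralLinearGroup.det : GL {i : Fin 3 // (id : Fin 3 → Fin 3) i = a} F →* Fˣ).comp (Pi.evalMonoidHom (fun b : Fin 3 => GL {i : Fin 3 // (id : Fin 3 → Fin 3) i = b} F) a)))) hθ η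
  refine ⟨hfd, h.trans (congrArg Finset.card (Finset.filter_congr fun w _ => ?_))⟩
  have hw : (fun m : (Π a : Fin 3, GL {i : Fin 3 // (id : Fin 3 → Fin 3) i = a} F) => ((((∏ a : Fin 3, ((θ) a).comp ((Matrix.GeneralLinearGroup.det : GL {i : Fin 3 // (id : Fin 3 → Fin 3) i = a} F →* Fˣ).comp (Pi.evalMonoidHom (fun b : Fin 3 => GL {i : Fin 3 // (id : Fin 3 → Fin 3) i = b} F) a)))) (leviProjection F (id : Fin 3 → Fin 3) ⟨(permGL (w) : GL (Fin 3) F) * blockDiagonalGL F (id : Fin 3 → Fin 3) m * (permGL (w) : GL (Fin 3) F)⁻¹, permGL_conj_blockDiagonalGL_mem_borel w m⟩) : ℂˣ) : ℂ)) =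
      fun m => (((∏ a : Fin 3, ((fun a => θ (w.symm a)) a).comp ((Matrix.GeneralLinearGroup.det : GL {i : Fin 3 // (id : Fin 3 → Fin 3) i = a} F →* Fˣ).comp (Pi.evalMonoidHom (fun b : Fin 3 => GL {i : Fin 3 // (id : Fin 3 → Fin 3) i = b} F) a))) m : ℂˣ) : ℂ) :=
    funext fun m => congrArg Units.val (tch_leviProjection_permGL_conj θ w m)
  rw [hw]

end LocalField

end Summit.HodgeConjecture.HodgeConjecture.Cruxes.H413.K2E3GL3PrincipalSeriesExponents
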